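import Summits.Ventures.HodgeRepro2.T5SU11KernelCompositionTransform
import Summits.Ventures.HodgeRepro2.T5SU11ResolventIterateTaylorUniform
import Summits.Ventures.HodgeRepro2.T5SU11KernelDiagonalJump
import Summits.Ventures.HodgeRepro2.T5SU11KernelCompositionUnique
import Summits.Ventures.HodgeRepro2.T5SU11KernelCompositionContinuous

/-!
# Summary XXVI — the exactness of the sharp disc, the uniform Taylor series of the powers, and the composed kernels as
iterated Green's functions (rows 607–613), under uniform names

Throughout `μ = λ(λ − 2)`, `K_λ` the kernel of `G^I_λ`, `K_λ^{∘(n+1)}(t, s) = (G^I_λ)ⁿ K_λ(·, s)(t)` the composed kernels,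
`Ξ = φ_1` the ground state, `W_1 = {|g| ≤ D Ξ}`.

* `ground_state_iterate`, `neumann_ground_state_summable_iff`, `neumann_ground_state_diverges`, `neumann_ground_state_hasSum` —
  **`(G^I_λ)^k Ξ = (−1/(μ + 1))^k Ξ`; the Neumann series on `Ξ` is summable iff `|μ − μ₂| < (λ₂ − 1)²`** (row 607);
* `kernel_ground_transform`, `kernel_comp_ground_transform`, `kernel_transform_series_summable_iff` — **`∫ K_λ^{∘(k+1)}(t, s) Ξ(t) sinh 2t dt
  = (−1/(μ + 1))^{k+1} Ξ(s)`; the kernel's Taylor radius is exact in the weak sense** (row 608);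
* `iterate_taylor_uniform` — **the Taylor series of `(G^I_λ)^{n+1} g`, `g ∈ W_1`, converges uniformly on `(0, ∞)`** (row 609);
* `kernel_ode_below`, `kernel_ode_above`, `kernel_comp_hasDerivAt`, `kernel_comp_hasDerivAt'`, `kernel_comp_iterated_green` —
  **`(L − μ) K_λ(·, s) = 0` off the diagonal; `(L − μ) K_λ^{∘(n+2)}(·, s) = K_λ^{∘(n+1)}(·, s)`** (row 610);
* `kernel_deriv_left`, `kernel_deriv_right`, `kernel_jump` — **the jump `∂_t K_λ(s⁺, s) − ∂_t K_λ(s⁻, s) = 1/sinh 2s`** (row 611);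
* `kernel_comp_bounded_origin`, `kernel_comp_little_o`, `kernel_comp_unique` — **`K_λ^{∘(n+2)}(·, s)` is THE solution of
  `(L − μ) v = K_λ^{∘(n+1)}(·, s)` bounded at `0` and `o(φ_λ)`** (row 612);
* `kernel_continuous`, `kernel_comp_continuous` — **the kernel and every composed kernel are continuous on `(0, ∞)²`** (row 613).

Nothing is claimed about (N).

Blind lane: Mathlib + the HodgeRepro2 prefix only; no sorry; axioms ⊆ {propext, Classical.choice,
Quot.sound}.
-/

namespace Summit.Ventures.HodgeRepro2.T5SU11RadialSummaryXXVI

open Filter Topology MeasureTheory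
open Set (Ioi Ioc Iic Ici)
open T5SU11Cartan T5SU11SphericalFunction T5SU11SphericalDecay T5SU11SphericalSolutionSpaceAll T5SU11RadialGreenKernel
  T5SU11RadialGreenImproper T5SU11ResolventNeumannSharpRadius T5SU11KernelCompositionTransform
  T5SU11ResolventIterateTaylorUniform T5SU11KernelCompositionODE T5SU11KernelDiagonalJump
  T5SU11KernelCompositionUnique T5SU11KernelCompositionContinuous

section measure

variable [MeasurableSpace Circle] [BorelSpace Circle]

section sharp_disc

variable {lam lam₂ : ℝ} (hlam : 1 < lam) (hlam₂ : 1 < lam₂)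

include hlam in
/-- **`(G^I_λ)^k Ξ(t) = (−1/(μ + 1))^k Ξ(t)`** for `t > 0` (row 607). -/
theorem ground_state_iterate (k : ℕ) {t : ℝ} (ht : 0 < t) :
    ((greenSolI (fun t => sph lam (hyp t)) (sphDecay lam))^[k] (fun s => sph 1 (hyp s))) t
      = (-(1 / (lam * (lam - 2) + 1))) ^ k * sph 1 (hyp t) :=
  iterate_sph_one hlam k t ht

include hlam₂ in
/-- **The Neumann series on the ground state is summable iff `|μ − μ₂| < (λ₂ − 1)²`** (row 607). -/
theorem neumann_ground_state_summable_iff {t : ℝ} (ht : 0 < t) :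
    Summable (fun k : ℕ => (lam * (lam - 2) - lam₂ * (lam₂ - 2)) ^ k
        * ((greenSolI (fun t => sph lam₂ (hyp t)) (sphDecay lam₂))^[k + 1] (fun s => sph 1 (hyp s))) t)
      ↔ |lam * (lam - 2) - lam₂ * (lam₂ - 2)| < (lam₂ - 1) ^ 2 :=
  summable_neumann_sph_one_iff hlam₂ ht

include hlam₂ in
/-- **Divergence of the Neumann series on the ground state outside the sharp disc** (row 607). -/
theorem neumann_ground_state_diverges (hq : (lam₂ - 1) ^ 2 < |lam * (lam - 2) - lam₂ * (lam₂ - 2)|) {t : ℝ}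
    (ht : 0 < t) :
    ¬ Summable (fun k : ℕ => (lam * (lam - 2) - lam₂ * (lam₂ - 2)) ^ k
        * ((greenSolI (fun t => sph lam₂ (hyp t)) (sphDecay lam₂))^[k + 1] (fun s => sph 1 (hyp s))) t) :=
  not_summable_neumann_sph_one hlam₂ hq ht

include hlam₂ in
/-- **Inside the sharp disc the Neumann series on the ground state sums to `−Ξ(t)/(μ + 1)`** (row 607). -/
theorem neumann_ground_state_hasSum (hq : |lam * (lam - 2) - lam₂ * (lam₂ - 2)| < (lam₂ - 1) ^ 2) {t : ℝ}
    (ht : 0 < t) :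
    HasSum (fun k : ℕ => (lam * (lam - 2) - lam₂ * (lam₂ - 2)) ^ k
        * ((greenSolI (fun t => sph lam₂ (hyp t)) (sphDecay lam₂))^[k + 1] (fun s => sph 1 (hyp s))) t)
      (-(sph 1 (hyp t) / (lam * (lam - 2) + 1))) :=
  hasSum_neumann_sph_one hlam₂ hq ht

include hlam in
/-- **`∫ K_λ(t, s) Ξ(t) sinh 2t dt = −Ξ(s)/(μ + 1)`** (row 608). -/
theorem kernel_ground_transform {s : ℝ} (hs : 0 < s) :
    ∫ t in Ioi 0, sphGreenKernel lam t s * sph 1 (hyp t) * Real.sinh (2 * t)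
      = -(sph 1 (hyp s) / (lam * (lam - 2) + 1)) :=
  transform_kernel hlam hs

include hlam in
/-- **`∫ K_λ^{∘(k+1)}(t, s) Ξ(t) sinh 2t dt = (−1/(μ + 1))^{k+1} Ξ(s)`** (row 608). -/
theorem kernel_comp_ground_transform {s : ℝ} (hs : 0 < s) (k : ℕ) :
    ∫ t in Ioi 0, ((greenSolI (fun t => sph lam (hyp t)) (sphDecay lam))^[k] (fun r => sphGreenKernel lam r s)) t
        * sph 1 (hyp t) * Real.sinh (2 * t)
      = (-(1 / (lam * (lam - 2) + 1))) ^ (k + 1) * sph 1 (hyp s) :=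
  transform_kernel_comp hlam hs k

include hlam₂ in
/-- **The kernel's Taylor coefficients paired with `Ξ` form a series summable iff `|μ − μ₂| < (λ₂ − 1)²`** (row 608). -/
theorem kernel_transform_series_summable_iff {s : ℝ} (hs : 0 < s) :
    Summable (fun k : ℕ => (lam * (lam - 2) - lam₂ * (lam₂ - 2)) ^ k
        * ∫ t in Ioi 0, ((greenSolI (fun t => sph lam₂ (hyp t)) (sphDecay lam₂))^[k] (fun r => sphGreenKernel lam₂ r s)) t
          * sph 1 (hyp t) * Real.sinh (2 * t))
      ↔ |lam * (lam - 2) - lam₂ * (lam₂ - 2)| < (lam₂ - 1) ^ 2 :=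
  summable_kernel_transform_iff hlam₂ hs

include hlam hlam₂ in
/-- **The Taylor series of the powers of the resolvent converges uniformly on `(0, ∞)`** for `g ∈ W_1` (row 609). -/
theorem iterate_taylor_uniform {g : ℝ → ℝ} (hg : ContinuousOn g (Ioi 0)) {D : ℝ}
    (hD : ∀ s, 0 < s → |g s| ≤ D * sph 1 (hyp s)) (hq : |lam * (lam - 2) - lam₂ * (lam₂ - 2)| < (lam₂ - 1) ^ 2) (n : ℕ) :
    TendstoUniformlyOn
      (fun N t => ∑ k ∈ Finset.range N, (lam * (lam - 2) - lam₂ * (lam₂ - 2)) ^ k * (((n + k).choose k : ℝ)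
        * ((greenSolI (fun t => sph lam₂ (hyp t)) (sphDecay lam₂))^[n + k + 1] g) t))
      (fun t => ((greenSolI (fun t => sph lam (hyp t)) (sphDecay lam))^[n + 1] g) t) atTop (Ioi 0) :=
  tendstoUniformlyOn_iterate_taylor hlam hlam₂ hg hD hq n

end sharp_disc

section green

variable {lam : ℝ} (hlam : 1 < lam) {s : ℝ} (hs : 0 < s)

/-- **`(L − μ) K_λ(·, s) = 0` on `(0, s)`** (row 610). -/
theorem kernel_ode_below {t : ℝ} (ht : 0 < t) (hts : t < s) :
    (∀ᶠ r in 𝓝 t, sphGreenKernel lam r s = -(sphDecay lam s * sph lam (hyp r))) ∧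
    HasDerivAt (fun r => sphGreenKernel lam r s) (-(sphDecay lam s * deriv (fun t => sph lam (hyp t)) t)) t ∧
    Real.sinh (2 * t) * (-(sphDecay lam s * deriv (deriv fun t => sph lam (hyp t)) t))
        + 2 * Real.cosh (2 * t) * (-(sphDecay lam s * deriv (fun t => sph lam (hyp t)) t))
      = lam * (lam - 2) * Real.sinh (2 * t) * sphGreenKernel lam t s :=
  kernel_ode_of_lt ht hts

include hlam hs in
/-- **`(L − μ) K_λ(·, s) = 0` on `(s, ∞)`** (row 610). -/
theorem kernel_ode_above {t : ℝ} (hst : s < t) :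
    (∀ᶠ r in 𝓝 t, sphGreenKernel lam r s = -(sph lam (hyp s) * sphDecay lam r)) ∧
    HasDerivAt (fun r => sphGreenKernel lam r s) (-(sph lam (hyp s) * sphDecay' lam t)) t ∧
    Real.sinh (2 * t) * (-(sph lam (hyp s) * sphDecay'' lam t))
        + 2 * Real.cosh (2 * t) * (-(sph lam (hyp s) * sphDecay' lam t))
      = lam * (lam - 2) * Real.sinh (2 * t) * sphGreenKernel lam t s :=
  kernel_ode_of_gt hlam hs hst

include hlam hs in
/-- **The derivative of `K_λ^{∘(n+2)}(·, s)`** on `(0, ∞)` (row 610). -/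
theorem kernel_comp_hasDerivAt (n : ℕ) {t : ℝ} (ht : 0 < t) :
    HasDerivAt ((greenSolI (fun t => sph lam (hyp t)) (sphDecay lam))^[n + 1] (fun r => sphGreenKernel lam r s))
      (greenSolI' (deriv fun t => sph lam (hyp t)) (sphDecay' lam) (fun t => sph lam (hyp t)) (sphDecay lam)
        ((greenSolI (fun t => sph lam (hyp t)) (sphDecay lam))^[n] (fun r => sphGreenKernel lam r s)) t) t :=
  hasDerivAt_kernel_comp_succ hlam hs n ht

include hlam hs in
/-- **The second derivative of `K_λ^{∘(n+2)}(·, s)`** on `(0, ∞)` (row 610). -/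
theorem kernel_comp_hasDerivAt' (n : ℕ) {t : ℝ} (ht : 0 < t) :
    HasDerivAt (greenSolI' (deriv fun t => sph lam (hyp t)) (sphDecay' lam) (fun t => sph lam (hyp t)) (sphDecay lam)
        ((greenSolI (fun t => sph lam (hyp t)) (sphDecay lam))^[n] (fun r => sphGreenKernel lam r s)))
      (greenSolI'' (deriv (deriv fun t => sph lam (hyp t))) (sphDecay'' lam) (deriv fun t => sph lam (hyp t))
        (sphDecay' lam) (fun t => sph lam (hyp t)) (sphDecay lam)
        ((greenSolI (fun t => sph lam (hyp t)) (sphDecay lam))^[n] (fun r => sphGreenKernel lam r s)) t) t :=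
  hasDerivAt_kernel_comp_succ' hlam hs n ht

include hlam in
/-- **`(L − μ) K_λ^{∘(n+2)}(·, s) = K_λ^{∘(n+1)}(·, s)`** on `(0, ∞)` (row 610). -/
theorem kernel_comp_iterated_green (n : ℕ) {t : ℝ} (ht : 0 < t) :
    Real.sinh (2 * t) * greenSolI'' (deriv (deriv fun t => sph lam (hyp t))) (sphDecay'' lam)
          (deriv fun t => sph lam (hyp t)) (sphDecay' lam) (fun t => sph lam (hyp t)) (sphDecay lam)
          ((greenSolI (fun t => sph lam (hyp t)) (sphDecay lam))^[n] (fun r => sphGreenKernel lam r s)) t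
        + 2 * Real.cosh (2 * t) * greenSolI' (deriv fun t => sph lam (hyp t)) (sphDecay' lam)
          (fun t => sph lam (hyp t)) (sphDecay lam)
          ((greenSolI (fun t => sph lam (hyp t)) (sphDecay lam))^[n] (fun r => sphGreenKernel lam r s)) t
      = lam * (lam - 2) * Real.sinh (2 * t)
          * ((greenSolI (fun t => sph lam (hyp t)) (sphDecay lam))^[n + 1] (fun r => sphGreenKernel lam r s)) t
        + Real.sinh (2 * t)
          * ((greenSolI (fun t => sph lam (hyp t)) (sphDecay lam))^[n] (fun r => sphGreenKernel lam r s)) t :=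
  kernel_comp_ode hlam n ht

include hs in
/-- **The left derivative of `K_λ(·, s)` at the diagonal** is `−χ_λ(s) φ_λ′(s)` (row 611). -/
theorem kernel_deriv_left :
    HasDerivWithinAt (fun r => sphGreenKernel lam r s) (-(sphDecay lam s * deriv (fun t => sph lam (hyp t)) s))
      (Iic s) s :=
  hasDerivWithinAt_kernel_Iic hs

include hlam hs in
/-- **The right derivative of `K_λ(·, s)` at the diagonal** is `−φ_λ(a_s) χ_λ′(s)` (row 611). -/
theorem kernel_deriv_right :
    HasDerivWithinAt (fun r => sphGreenKernel lam r s) (-(sph lam (hyp s) * sphDecay' lam s)) (Ici s) s :=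
  hasDerivWithinAt_kernel_Ici hlam hs

include hlam hs in
/-- **The jump relation `∂_t K_λ(s⁺, s) − ∂_t K_λ(s⁻, s) = 1/sinh 2s`** (row 611). -/
theorem kernel_jump :
    -(sph lam (hyp s) * sphDecay' lam s) - (-(sphDecay lam s * deriv (fun t => sph lam (hyp t)) s))
      = 1 / Real.sinh (2 * s) :=
  kernel_deriv_jump hlam hs

include hlam hs in
/-- **The composed kernels are bounded near the origin** (row 612). -/
theorem kernel_comp_bounded_origin (m : ℕ) :
    ∃ B : ℝ, ∀ᶠ t in 𝓝[>] (0 : ℝ),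
      |((greenSolI (fun t => sph lam (hyp t)) (sphDecay lam))^[m] (fun r => sphGreenKernel lam r s)) t| ≤ B :=
  kernel_comp_bounded_nhdsGT_zero hlam hs m

include hlam hs in
/-- **The composed kernels are `o(φ_λ)` at infinity** (row 612). -/
theorem kernel_comp_little_o (m : ℕ) :
    Tendsto (fun t => ((greenSolI (fun t => sph lam (hyp t)) (sphDecay lam))^[m] (fun r => sphGreenKernel lam r s)) t
      / sph lam (hyp t)) atTop (𝓝 0) :=
  tendsto_kernel_comp_div_sph_atTop hlam hs m

include hlam hs in
/-- **Uniqueness**: a `C²` solution of `(L − μ) v = K_λ^{∘(n+1)}(·, s)`, bounded at `0` and `o(φ_λ)` at infinity, is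
`K_λ^{∘(n+2)}(·, s)` (row 612). -/
theorem kernel_comp_unique (n : ℕ) {v v' v'' : ℝ → ℝ}
    (hv : ∀ t, 0 < t → HasDerivAt v (v' t) t) (hv' : ∀ t, 0 < t → HasDerivAt v' (v'' t) t)
    (hvode : ∀ t, 0 < t → Real.sinh (2 * t) * v'' t + 2 * Real.cosh (2 * t) * v' t
      = lam * (lam - 2) * Real.sinh (2 * t) * v t + Real.sinh (2 * t)
        * ((greenSolI (fun t => sph lam (hyp t)) (sphDecay lam))^[n] (fun r => sphGreenKernel lam r s)) t)
    {B : ℝ} (hB : ∀ᶠ t in 𝓝[>] (0 : ℝ), |v t| ≤ B)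
    (hdecay : Tendsto (fun t => v t / sph lam (hyp t)) atTop (𝓝 0)) {t : ℝ} (ht : 0 < t) :
    v t = ((greenSolI (fun t => sph lam (hyp t)) (sphDecay lam))^[n + 1] (fun r => sphGreenKernel lam r s)) t :=
  eq_kernel_comp_succ_of_ode hlam hs n hv hv' hvode hB hdecay ht

include hlam in
/-- **The kernel is continuous on `(0, ∞)²`** (row 613). -/
theorem kernel_continuous : ContinuousOn (fun p : ℝ × ℝ => sphGreenKernel lam p.1 p.2) (Ioi 0 ×ˢ Ioi 0) :=
  continuousOn_sphGreenKernel_prod hlam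

include hlam in
/-- **Every composed kernel is continuous on `(0, ∞)²`** (row 613). -/
theorem kernel_comp_continuous (n : ℕ) :
    ContinuousOn (fun p : ℝ × ℝ => ((greenSolI (fun t => sph lam (hyp t)) (sphDecay lam))^[n]
      (fun r => sphGreenKernel lam r p.2)) p.1) (Ioi 0 ×ˢ Ioi 0) :=
  continuousOn_kernel_comp_prod hlam n

end green

end measure

end Summit.Ventures.HodgeRepro2.T5SU11RadialSummaryXXVI
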